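import Summits.Parity.GeneralizedHardyLittlewood.Theorems.PrimeLevelFamEdgeMomentsBeyondDiagonalDiagRemTwoTwoColumns
import HarnessLib

/-!
# Route `PrimeLevelFamEdge`, crux K_A `MomentsBeyondDiagonal` (stmt-Parity-20007), line «petersson_layers» v4, stub `stub_diag`:
# **the `15P₂³ − 30P₂P₄ + 16P₆`-decorated column of the order-`(3,3)` remainder weight — trivial bounds** (brick of (R₃₃))

The Hecke-summed weight of order `(3,3)` (`…DiagDecorOrderThreeThreeHecke.selbergOrderThreeThree_hecke_eq`; hypothesis `hR` of
`…DiagDecorOrderThreeThreeAssembly.orderThreeThree_target_of_poly_of_remainder`) has, against `r₀₀`, the sextic decoration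
`−(15S₂³ − 30S₂S₄ + 16S₆)/64`, `S_m = P_m(k₁) + P_m(k₂)`, `P_m(k) = Σ_{p∣k} logᵐp`; its one-sided part is the NEW column
`D₆(k) = 15P₂(k)³ − 30P₂(k)P₄(k) + 16P₆(k)` (the mixed parts are `P₂ ⊗ (45P₂² − 30P₄) = 15·P₂ ⊗ (3P₂²−2P₄)`, both-sided, treated by
δ-subtraction). As for the quartic column `3P₂² − 2P₄` of order `(2,2)` (`…DiagRemTwoTwoColumns`, p831205), a column only needs
bounded partial sums and absolute first moments — the trivial bounds `|D₆(k)| ≤ 61 log⁶k`: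

* `abs_decorSix_le` — `|15P₂³ − 30P₂P₄ + 16P₆|(k) ≤ 61 log⁶ k`;
* `sum_tau_div_decorSix_ellp_pow_le` — `Σ_{k≤Y} (τ(k)/k)|D₆(k)|ℓ⁺(k)^m ≤ 61·log^mY·(1+log Y)⁸`;
* `abs_sum_copTauW_decorSix_le` — **`|Σ_{k≤e} a_n(k)D₆(k)| ≤ 61(1+log Y)⁸`** (`e ≤ ⌊Y⌋`);
* `sum_abs_copTauW_decorSix_ellp_pow_le` — **`Σ_{k≤Y} |a_n(k)D₆(k)|ℓ⁺(k)^m ≤ 61·log^mY·(1+log Y)⁸`.**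

Def-free; theorems only. Helper `--supports stmt-Parity-20007`; closes nothing; K_A, K_B and the Parity summit are NOT proved;
nothing about Landau–Siegel zeros.

## References
* E. Kowalski, P. Michel, J. VanderKam, J. reine angew. Math. 526 (2000), (22)–(28) pp. 12–15 and Prop. 5.1 p. 18.
  [cite: KowalskiMichelVanderKam2000, Prop. 5.1 — derivation (decorated remainder monomials of order (3,3))]
-/

noncomputable section

open Real Finset

namespace Summit.Parity.GeneralizedHardyLittlewood.Theorems.MomentsBeyondDiagonal.DiagCorner

open Literature.Barriers.Parity (Icc_one_eq_Ioc_zero)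
open Summit.Parity.GeneralizedHardyLittlewood.Theorems.BeyondDiagonalBeatsQuarter.KernelFormXSq
  (copTauW copTauW_apply divWeight divWeight_nonneg abs_W_le)
open Summit.Parity.GeneralizedHardyLittlewood.Theorems.BeyondDiagonalBeatsQuarter.Corner

/-! ### The `15P₂³ − 30P₂P₄ + 16P₆`-decorated column -/

/-- `|15P₂(k)³ − 30P₂(k)P₄(k) + 16P₆(k)| ≤ 61 log⁶k` (`k ≥ 1`). [folklore] -/
theorem abs_decorSix_le {k : ℕ} (hk : k ≠ 0) :
    |15 * (∑ p ∈ k.primeFactors, Real.log p ^ 2) ^ 3 - 30 * (∑ p ∈ k.primeFactors, Real.log p ^ 2) * (∑ p ∈ k.primeFactors, Real.log p ^ 4) + 16 * ∑ p ∈ k.primeFactors, Real.log p ^ 6| ≤ 61 * Real.log k ^ 6 := by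
  have h2 := sum_primeFactors_log_pow_le hk (show 1 ≤ 2 by norm_num)
  have h4 := sum_primeFactors_log_pow_le hk (show 1 ≤ 4 by norm_num)
  have h6 := sum_primeFactors_log_pow_le hk (show 1 ≤ 6 by norm_num)
  have h20 : 0 ≤ ∑ p ∈ k.primeFactors, Real.log p ^ 2 := Finset.sum_nonneg fun p _ ↦ sq_nonneg _
  have h40 : 0 ≤ ∑ p ∈ k.primeFactors, Real.log p ^ 4 := Finset.sum_nonneg fun p _ ↦ by positivity
  have h60 : 0 ≤ ∑ p ∈ k.primeFactors, Real.log p ^ 6 := Finset.sum_nonneg fun p _ ↦ by positivity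
  have hlogk : 0 ≤ Real.log k := Real.log_nonneg (by exact_mod_cast Nat.one_le_iff_ne_zero.2 hk)
  have h222 : (∑ p ∈ k.primeFactors, Real.log p ^ 2) ^ 3 ≤ (Real.log k ^ 2) ^ 3 := pow_le_pow_left₀ h20 h2 3
  have h24 : (∑ p ∈ k.primeFactors, Real.log p ^ 2) * (∑ p ∈ k.primeFactors, Real.log p ^ 4) ≤
      Real.log k ^ 2 * Real.log k ^ 4 := mul_le_mul h2 h4 h40 (by positivity)
  have h240 : 0 ≤ (∑ p ∈ k.primeFactors, Real.log p ^ 2) * (∑ p ∈ k.primeFactors, Real.log p ^ 4) :=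
    mul_nonneg h20 h40
  have h30 : 0 ≤ (∑ p ∈ k.primeFactors, Real.log p ^ 2) ^ 3 := pow_nonneg h20 3
  have e6 : (Real.log k ^ 2) ^ 3 = Real.log k ^ 6 := by ring
  have e24 : Real.log k ^ 2 * Real.log k ^ 4 = Real.log k ^ 6 := by ring
  rw [e6] at h222
  rw [e24] at h24
  rw [abs_le]
  constructor <;> nlinarith

/-- `Σ_{k≤Y} (τ(k)/k)·|D₆(k)|·ℓ⁺(k)^m ≤ 61·log^mY·(1+log Y)⁸` (`Y ≥ 1`). [folklore] -/
theorem sum_tau_div_decorSix_ellp_pow_le (m : ℕ) {Y : ℝ} (hY : 1 ≤ Y) :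
    ∑ k ∈ Icc 1 ⌊Y⌋₊, (k.divisors.card : ℝ) / k *
        |15 * (∑ p ∈ k.primeFactors, Real.log p ^ 2) ^ 3 - 30 * (∑ p ∈ k.primeFactors, Real.log p ^ 2) * (∑ p ∈ k.primeFactors, Real.log p ^ 4) + 16 * ∑ p ∈ k.primeFactors, Real.log p ^ 6| * ellp Y k ^ m ≤
      61 * Real.log Y ^ m * (1 + Real.log Y) ^ 8 := by
  have hY0 : 0 < Y := by linarith
  have hLY : 0 ≤ Real.log Y := Real.log_nonneg hY
  have h1 : ∀ k ∈ Icc 1 ⌊Y⌋₊, (k.divisors.card : ℝ) / k *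
      |15 * (∑ p ∈ k.primeFactors, Real.log p ^ 2) ^ 3 - 30 * (∑ p ∈ k.primeFactors, Real.log p ^ 2) * (∑ p ∈ k.primeFactors, Real.log p ^ 4) + 16 * ∑ p ∈ k.primeFactors, Real.log p ^ 6| * ellp Y k ^ m ≤
      (k.divisors.card : ℝ) / k * (61 * Real.log Y ^ 6 * Real.log Y ^ m) := by
    intro k hk
    have hk1 := (Finset.mem_Icc.1 hk).1
    have hkY : (k : ℝ) ≤ Y := le_trans (by exact_mod_cast (Finset.mem_Icc.1 hk).2) (Nat.floor_le hY0.le)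
    have hk0 : k ≠ 0 := by omega
    have hlogk : Real.log k ≤ Real.log Y := Real.log_le_log (by exact_mod_cast hk1) hkY
    have hlogk0 : 0 ≤ Real.log k := Real.log_nonneg (by exact_mod_cast hk1)
    have hD : |15 * (∑ p ∈ k.primeFactors, Real.log p ^ 2) ^ 3 - 30 * (∑ p ∈ k.primeFactors, Real.log p ^ 2) * (∑ p ∈ k.primeFactors, Real.log p ^ 4) + 16 * ∑ p ∈ k.primeFactors, Real.log p ^ 6| ≤
        61 * Real.log Y ^ 6 :=
      (abs_decorSix_le hk0).trans (by gcongr)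
    have hl : ellp Y k ^ m ≤ Real.log Y ^ m := pow_le_pow_left₀ (ellp_nonneg Y k) (ellp_le_log hY hk1) m
    rw [mul_assoc]
    refine mul_le_mul_of_nonneg_left ?_ (by positivity)
    exact mul_le_mul hD hl (pow_nonneg (ellp_nonneg Y k) m) (by positivity)
  refine (Finset.sum_le_sum h1).trans ?_
  rw [← Finset.sum_mul]
  have h2 : ∑ k ∈ Icc 1 ⌊Y⌋₊, (k.divisors.card : ℝ) / k ≤ (1 + Real.log ⌊Y⌋₊) ^ 2 := by
    rw [Icc_one_eq_Ioc_zero]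
    exact Literature.NumberTheory.Sieve.Vaughan.sum_card_divisors_div_le ⌊Y⌋₊
  have h3 : (1 + Real.log ⌊Y⌋₊) ^ 2 ≤ (1 + Real.log Y) ^ 2 := by
    have hf1 : (1 : ℝ) ≤ ⌊Y⌋₊ := by exact_mod_cast Nat.le_floor (by simpa using hY)
    have : Real.log (⌊Y⌋₊ : ℝ) ≤ Real.log Y := Real.log_le_log (by linarith) (Nat.floor_le hY0.le)
    have : 0 ≤ Real.log (⌊Y⌋₊ : ℝ) := Real.log_nonneg hf1
    nlinarith
  have h4 : Real.log Y ^ 6 ≤ (1 + Real.log Y) ^ 6 := pow_le_pow_left₀ hLY (by linarith) 6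
  calc (∑ k ∈ Icc 1 ⌊Y⌋₊, (k.divisors.card : ℝ) / k) * (61 * Real.log Y ^ 6 * Real.log Y ^ m)
      ≤ (1 + Real.log Y) ^ 2 * (61 * (1 + Real.log Y) ^ 6 * Real.log Y ^ m) := by
        refine mul_le_mul (h2.trans h3) ?_ (by positivity) (by positivity)
        exact mul_le_mul_of_nonneg_right (by linarith) (pow_nonneg hLY m)
    _ = 61 * Real.log Y ^ m * (1 + Real.log Y) ^ 8 := by ring

/-- Partial sums of the `D₆`-decorated column: `|Σ_{k≤e} a_n(k)D₆(k)| ≤ 61(1+log Y)⁸` for `e ≤ ⌊Y⌋`. [folklore] -/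
theorem abs_sum_copTauW_decorSix_le (n : ℕ) {Y : ℝ} (hY : 1 ≤ Y) {e : ℕ} (he : e ≤ ⌊Y⌋₊) :
    |∑ k ∈ Icc 1 e, copTauW n k *
        (15 * (∑ p ∈ k.primeFactors, Real.log p ^ 2) ^ 3 - 30 * (∑ p ∈ k.primeFactors, Real.log p ^ 2) * (∑ p ∈ k.primeFactors, Real.log p ^ 4) + 16 * ∑ p ∈ k.primeFactors, Real.log p ^ 6)| ≤
      61 * (1 + Real.log Y) ^ 8 := by
  have h := sum_tau_div_decorSix_ellp_pow_le 0 hY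
  simp only [pow_zero, mul_one] at h
  calc _ ≤ ∑ k ∈ Icc 1 e, |copTauW n k *
          (15 * (∑ p ∈ k.primeFactors, Real.log p ^ 2) ^ 3 - 30 * (∑ p ∈ k.primeFactors, Real.log p ^ 2) * (∑ p ∈ k.primeFactors, Real.log p ^ 4) + 16 * ∑ p ∈ k.primeFactors, Real.log p ^ 6)| :=
        Finset.abs_sum_le_sum_abs _ _
    _ ≤ ∑ k ∈ Icc 1 ⌊Y⌋₊, |copTauW n k *
          (15 * (∑ p ∈ k.primeFactors, Real.log p ^ 2) ^ 3 - 30 * (∑ p ∈ k.primeFactors, Real.log p ^ 2) * (∑ p ∈ k.primeFactors, Real.log p ^ 4) + 16 * ∑ p ∈ k.primeFactors, Real.log p ^ 6)| :=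
        Finset.sum_le_sum_of_subset_of_nonneg (Finset.Icc_subset_Icc_right he) fun _ _ _ ↦ abs_nonneg _
    _ ≤ ∑ k ∈ Icc 1 ⌊Y⌋₊, (k.divisors.card : ℝ) / k *
          |15 * (∑ p ∈ k.primeFactors, Real.log p ^ 2) ^ 3 - 30 * (∑ p ∈ k.primeFactors, Real.log p ^ 2) * (∑ p ∈ k.primeFactors, Real.log p ^ 4) + 16 * ∑ p ∈ k.primeFactors, Real.log p ^ 6| := by
        refine Finset.sum_le_sum fun k _ ↦ ?_
        rw [abs_mul]
        exact mul_le_mul_of_nonneg_right (abs_copTauW_le n k) (abs_nonneg _)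
    _ ≤ 61 * (1 + Real.log Y) ^ 8 := by simpa using h

/-- `Σ_{k≤Y} |a_n(k)D₆(k)|·ℓ⁺(k)^m ≤ 61·log^mY·(1+log Y)⁸`. [folklore] -/
theorem sum_abs_copTauW_decorSix_ellp_pow_le (n m : ℕ) {Y : ℝ} (hY : 1 ≤ Y) :
    ∑ k ∈ Icc 1 ⌊Y⌋₊, |copTauW n k *
        (15 * (∑ p ∈ k.primeFactors, Real.log p ^ 2) ^ 3 - 30 * (∑ p ∈ k.primeFactors, Real.log p ^ 2) * (∑ p ∈ k.primeFactors, Real.log p ^ 4) + 16 * ∑ p ∈ k.primeFactors, Real.log p ^ 6)| * ellp Y k ^ m ≤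
      61 * Real.log Y ^ m * (1 + Real.log Y) ^ 8 := by
  refine le_trans (Finset.sum_le_sum fun k _ ↦ ?_) (sum_tau_div_decorSix_ellp_pow_le m hY)
  rw [abs_mul]
  exact mul_le_mul_of_nonneg_right (mul_le_mul_of_nonneg_right (abs_copTauW_le n k) (abs_nonneg _))
    (pow_nonneg (ellp_nonneg Y k) m)

end Summit.Parity.GeneralizedHardyLittlewood.Theorems.MomentsBeyondDiagonal.DiagCorner

end
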